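import Summits.AtomisticToContinuum.Crystallization.Theorems.FrustratedLawDichotomyCellF1cCert
import Summits.AtomisticToContinuum.Crystallization.Theorems.FrustratedLawDichotomyCellF1cAtlas

/-!
# FrustratedLawDichotomy · crux `AperiodicFrustratedLawGap` (stmt-AtomisticToContinuum-27623) — class-A K-file tower, layer 10c′:
# the certified F1 floor UNDER ZONE TRANSPORT, UNCONDITIONAL (decomp-a2c hand-2 g49; (334) AtlasDoorPull `hfloor` shape, #103 `HostLikeAt` mark of record)

#119 `…CellF1cAtlas.hfloor_KF1c_transport` is the (334) zone-transport form of the F1 floor, modulo the K-certificate.  With #129 `certF1c` it becomes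
unconditional: for every atlas `𝓐 ⊇ pairsF1c` and pull radius `R`, every rooted `7/10`-hard-core NASH configuration of the F1 row of record `KF1c` has
`e⋆ + 23/10⁴ ≤ rootEnergy V_LJ μ + net 0 (zonePull (HostLikeAt (7/10) 2⁻¹⁰ 𝓐) R) μ` (★ `hfloor_KF1c_transport_cert`) — the `hfloor` line of the F1 row for
the (334) atlas door BY NAME, no hypothesis beyond the atlas bookkeeping.
Imports TREE #129 `…CellF1cCert` + #119 `…CellF1cAtlas`; one theorem; 0 sorry.  Tags: [new: K-file certificate]; nothing here closes an item.
-/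

noncomputable section

namespace Summit.AtomisticToContinuum.Crystallization.Theorems.FrustratedLawDichotomyCellF1cCertTransport

open MeasureTheory
open Literature.MathematicalPhysics.StatisticalMechanics (lennardJones rootEnergy)
open Literature.Probability.Process (IsRootedHardCore)
open Summit.AtomisticToContinuum.Crystallization.Theorems.ChargedEnergyGapNegative (E3 eStar)
open Summit.AtomisticToContinuum.Crystallization.Theorems.FrustratedLawDichotomySignedLedger (net)
open Summit.AtomisticToContinuum.Crystallization.Theorems.FrustratedLawDichotomyPullKernel (zonePull)
open Summit.AtomisticToContinuum.Crystallization.Theorems.FrustratedLawDichotomyZoneKernel (HostLikeAt)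
open Summit.AtomisticToContinuum.Crystallization.Theorems.FrustratedLawDichotomyCellF1cRow (KF1c)
open Summit.AtomisticToContinuum.Crystallization.Theorems.FrustratedLawDichotomyCellF1cAtlas (pairsF1c hfloor_KF1c_transport)
open Summit.AtomisticToContinuum.Crystallization.Theorems.FrustratedLawDichotomyCellF1cCert (certF1c)
open Summit.AtomisticToContinuum.Crystallization.Theorems.FrustratedLawDichotomyPeriodicEnergyCeilingKernel (eStar_le)

/-- ★ **THE F1 FLOOR UNDER ZONE TRANSPORT, UNCONDITIONAL**: for every atlas `𝓐 ⊇ pairsF1c` and pull radius `R`, every rooted `7/10`-hard-core NASH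
configuration `μ ∈ KF1c` has `e⋆ + 23/10⁴ ≤ rootEnergy V_LJ μ + net 0 (zonePull (HostLikeAt (7/10) 2⁻¹⁰ 𝓐) R) μ` (#119 with `hcert :=` #129 `certF1c`,
`hc :=` tree `eStar_le`). [new: K-file certificate] -/
theorem hfloor_KF1c_transport_cert {𝓐 : Set (Finset E3 × Set E3)} (h𝓐 : pairsF1c ⊆ 𝓐) (R : ℝ) :
    ∀ μ : Measure E3, IsRootedHardCore (7 / 10) μ →
      (∀ p : E3, μ {p} ≠ 0 → ∀ w : E3, (∀ q : E3, μ {q} ≠ 0 → q ≠ p → w ≠ q) →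
        ∑' q : {q : E3 // μ {q} ≠ 0 ∧ q ≠ p}, lennardJones (dist p (q : E3)) ≤
          ∑' q : {q : E3 // μ {q} ≠ 0 ∧ q ≠ p}, lennardJones (dist w (q : E3))) →
      μ ∈ KF1c → eStar + 23 / 10000 ≤ rootEnergy lennardJones μ + net 0 (zonePull (HostLikeAt (7 / 10) (1 / 1024) 𝓐) R) μ := by
  have hc : eStar ≤ ((-(7175 / 10000) : ℚ) : ℝ) := by push_cast; exact eStar_le
  have h := hfloor_KF1c_transport hc certF1c h𝓐 R
  push_cast at h
  exact h

end Summit.AtomisticToContinuum.Crystallization.Theorems.FrustratedLawDichotomyCellF1cCertTransport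

end
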